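import Literature.NumberTheory.LFunctions.Zhang2022.AppendixBVarrhoB1
import Literature.NumberTheory.LFunctions.Zhang2022.RepairGapLemma31ScaleLaw
import Literature.NumberTheory.LFunctions.Zhang2022.Section10TentMellin
import HarnessLib

/-!
# Zhang (2022), rescue GAP/REQSIDE (D-0124 (4)–(5)): the SCALE LAW of (B.1) — the Appendix-B display
# `Σ_{n≤X,(n,𝔮)=1} |ϱ_j(n) − ϱ*_j(n)|/n ≪ 𝓛⁻⁸` holds under (A) at exponent `81` (saving `70` of Lemma 3.1,
# split free), against `2021` AS TYPED (the tree hard-codes `√𝓛²⁰¹⁰ = 𝓛¹⁰⁰⁵`)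

Topic `Literature/NumberTheory/LFunctions/Zhang2022` (Landau–Siegel audit tree; verdict-neutral).
Y. Zhang, *Discrete mean estimates and the Landau–Siegel zero*, arXiv:2211.02515v1 (2022)
[Zhang2022LandauSiegel] — **an unrefereed manuscript under adjudication; nothing in this file asserts or
denies its Theorems 1–2, and nothing here is a claim about Landau–Siegel zeros. The programme SEARCHES and
TYPES; no claim about Landau–Siegel zeros, Theorems 1–2 of arXiv:2211.02515 or a repaired Margin232 until a
kernel theorem says so.**

(B.1) (Appendix B, proof of Lemma 15.1, p. 106: "`Σ_{n<P,(n,𝔮)=1} |ϱ_j(n) − ϱ*_j(n)|/n ≪ 𝓛⁻⁸`") is the tree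
theorem `AppendixBVarrho.appB1_bound` (file `AppendixBVarrhoB1`): divisor-sum swap
(`AppendixBVarrho.sum_coprime_norm_sub_le`: `≤ H²·Σ_{D⁴<h≤X}|ν(h)|/h`, `H = Σ_{k≤X}1/k ≤ 3𝓛⁹`), Cauchy–Schwarz
`Σ|ν(h)|/h ≤ √L·√H`, and Lemma 3.1 for `L = Σ_{D⁴<h≤X}|ν(h)|²/h`. The tree takes `√L ≤ √|C|/𝓛¹⁰⁰⁵` from the
PRINTED `L ≤ C𝓛⁻²⁰¹¹` and lands with room (`27√C·𝓛²⁷/𝓛¹⁰⁰⁵ ≤ 27√C/𝓛⁸`, "in fact `≪ 𝓛⁻⁹⁷⁸`"); read with the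
exponent as a parameter that step consumes the saving `2010`, i.e. (A) at `2021` (bed-2 FINDINGS v0.24 §23).
This file re-runs the assembly with the split FREE over the Lemma 3.1 scale law
(`Repair.Gap.lemma31_scale_of_norm_le 9 k`): the conclusion `𝓛⁻⁸` needs `√L ≤ √|C|/𝓛³⁵`, i.e. saving `k ≥ 70`,
i.e. (A) at exponent `81`.

* `appB1_bound_scale_of_norm_le` — for every `j` and `X ≤ ⌊P²⌋`, the display with constant `27√|C|` from
  `‖L(1,χ)‖ ≤ 𝓛⁻⁸¹` (`= 𝓛^{−(70+2+9)}`), `log D ≥ 3`, `D ≥ 2` automatic;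
* `appB1_bound_of_assumptionAWith` — the `ForAllLarge` form under `Repair.Bed.AssumptionAWith E`, every real
  `E ≥ 81` (the tree's `appB1_bound` is the printed `E = 2022`; not restated).

READING (GAP G-31, as-typed vs needed): (B.1) costs (A) at `81` (needed, now kernel) against `2021` (as typed).
Sufficiency only; theorems only; no definition, no named fact; nothing about (A).

## References

* Y. Zhang, arXiv:2211.02515v1 (2022), Appendix B (B.1) p. 106; §3 Lemma 3.1; §15 (15.21).
  [cite: Zhang2022LandauSiegel, Appendix B (B.1)]
-/

noncomputable section

open Complex Real Finset ArithmeticFunction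

namespace Literature.NumberTheory.LFunctions.Zhang2022.Repair.Gap

open Literature.NumberTheory.LFunctions.Zhang2022 Skeleton
open Literature.NumberTheory.LFunctions.Zhang2022.AppendixBVarrho (sum_coprime_norm_sub_le prime_dvd_frakq)
open Literature.NumberTheory.LFunctions.Zhang2022.Repair.Bed (AssumptionAWith)

/-- Cauchy–Schwarz for the last step of (B.1): `Σ_{Y<h≤X} |ν(h)|/h ≤ (Σ_{Y<h≤X} |ν(h)|²/h)^{1/2}(Σ_{k≤X} 1/k)^{1/2}`
(the tree's private `AppendixBVarrho.sum_norm_div_le_sqrt`, restated because it is private there).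
[cite: Zhang2022LandauSiegel, Appendix B (B.1), proof] -/
theorem sum_norm_divisorSumChar_div_le_sqrt {D : ℕ} (χ : DirichletCharacter ℂ D) (Y X : ℕ) :
    ∑ h ∈ Ioc Y X, ‖divisorSumChar χ h‖ / h ≤
      Real.sqrt (∑ h ∈ Ioc Y X, ‖divisorSumChar χ h‖ ^ 2 / h) *
        Real.sqrt (∑ k ∈ Icc 1 X, (1 : ℝ) / k) := by
  have hcs := Finset.sum_mul_sq_le_sq_mul_sq (Ioc Y X)
    (fun h => ‖divisorSumChar χ h‖ / Real.sqrt h) (fun h => 1 / Real.sqrt h)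
  have hfg : ∀ h ∈ Ioc Y X, ‖divisorSumChar χ h‖ / Real.sqrt h * (1 / Real.sqrt h) =
      ‖divisorSumChar χ h‖ / h := by
    intro h hh
    have h0 : (0 : ℝ) ≤ h := Nat.cast_nonneg h
    rw [div_mul_div_comm, mul_one, Real.mul_self_sqrt h0]
  have hf2 : ∀ h ∈ Ioc Y X, (‖divisorSumChar χ h‖ / Real.sqrt h) ^ 2 = ‖divisorSumChar χ h‖ ^ 2 / h := by
    intro h hh
    rw [div_pow, Real.sq_sqrt (Nat.cast_nonneg h)]
  have hg2 : ∀ h ∈ Ioc Y X, (1 / Real.sqrt (h : ℝ)) ^ 2 = 1 / h := by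
    intro h hh
    rw [div_pow, one_pow, Real.sq_sqrt (Nat.cast_nonneg h)]
  rw [sum_congr rfl hfg, sum_congr rfl hf2, sum_congr rfl hg2] at hcs
  have hsub : ∑ h ∈ Ioc Y X, (1 : ℝ) / h ≤ ∑ k ∈ Icc 1 X, (1 : ℝ) / k := by
    refine sum_le_sum_of_subset_of_nonneg ?_ fun k _ _ => by positivity
    intro h hh; simp only [mem_Ioc, mem_Icc] at hh ⊢; omega
  have hA : 0 ≤ ∑ h ∈ Ioc Y X, ‖divisorSumChar χ h‖ ^ 2 / h := sum_nonneg fun h _ => by positivity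
  calc ∑ h ∈ Ioc Y X, ‖divisorSumChar χ h‖ / h
      ≤ |∑ h ∈ Ioc Y X, ‖divisorSumChar χ h‖ / h| := le_abs_self _
    _ ≤ Real.sqrt ((∑ h ∈ Ioc Y X, ‖divisorSumChar χ h‖ ^ 2 / h) * ∑ h ∈ Ioc Y X, (1 : ℝ) / h) :=
        Real.abs_le_sqrt hcs
    _ ≤ Real.sqrt ((∑ h ∈ Ioc Y X, ‖divisorSumChar χ h‖ ^ 2 / h) * ∑ k ∈ Icc 1 X, (1 : ℝ) / k) := by
        gcongr
    _ = _ := Real.sqrt_mul hA _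

/-- **(B.1) with the split free (sufficiency)**: there is an absolute `C` (`= 27√|C₃.₁(9,70)|`) such that for every
`D` with `log D ≥ 3`, every PRIMITIVE quadratic `χ` mod `D` with `‖L(1,χ)‖ ≤ (log D)^{−81}`, every `j` and every
`X ≤ ⌊P²⌋`: `Σ_{n≤X, (n,𝔮)=1} |ϱ_j(n) − ϱ*_j(n)|/n ≤ C/𝓛⁸`. The tree's `AppendixBVarrho.appB1_bound` verbatim
with Lemma 3.1 ↦ `lemma31_scale_of_norm_le 9 70` and `√L ≤ √|C|/𝓛¹⁰⁰⁵ ↦ √L ≤ √|C|/𝓛³⁵`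
(`27√C·𝓛²⁷/𝓛³⁵ = 27√C/𝓛⁸`). [cite: Zhang2022LandauSiegel, Appendix B (B.1)] -/
theorem appB1_bound_scale_of_norm_le (c' : ℝ) : ∃ C : ℝ, ∀ (D : ℕ) [NeZero D] (χ : DirichletCharacter ℂ D),
    χ.IsPrimitive → χ ^ 2 = 1 → 3 ≤ Real.log D →
    ‖χ.LFunction 1‖ ≤ 1 / Real.log D ^ 81 →
    ∀ j X : ℕ, X ≤ ⌊bigP D ^ 2⌋₊ →
      ∑ n ∈ (Icc 1 X).filter (fun n => Nat.Coprime n (frakq D)),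
        ‖(∑ d ∈ n.divisors, (ArithmeticFunction.moebius d : ℂ) * (d : ℂ) ^ betaJ c' D j) -
            varrhoStar c' χ j n‖ / n ≤ C / ell D ^ 8 := by
  obtain ⟨C, hC⟩ := lemma31_scale_of_norm_le 9 70 (by norm_num)
  refine ⟨27 * Real.sqrt |C|, fun D _ χ hp hχ2 hlog hA j X hX => ?_⟩
  -- the parameters
  have hD0 : (0 : ℝ) < D := by
    rcases Nat.eq_zero_or_pos D with h | h
    · subst h; norm_num [Real.log_zero] at hlog
    · exact_mod_cast h
  have hD3 : Real.exp 3 ≤ D := by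
    have := Real.exp_le_exp.2 hlog
    rwa [Real.exp_log hD0] at this
  have hD2 : 2 ≤ D := by
    have h4 : (4 : ℝ) ≤ Real.exp 3 := by linarith [Real.add_one_le_exp (3 : ℝ)]
    exact_mod_cast (show (2 : ℝ) ≤ D by linarith)
  have hℓ : 1 ≤ ell D := by unfold ell; linarith
  have hℓ0 : 0 < ell D := by linarith
  -- the Lemma 3.1 scale law at `N = X ≤ P²`, saving `70` from exponent `70 + 2 + 9 = 81`
  have hXP : (X : ℝ) ≤ Real.exp (2 * Real.log D ^ 9) := by
    calc (X : ℝ) ≤ ⌊bigP D ^ 2⌋₊ := by exact_mod_cast hX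
      _ ≤ bigP D ^ 2 := Nat.floor_le (by positivity)
      _ = Real.exp (2 * Real.log D ^ 9) := by unfold bigP ell; rw [← Real.exp_nat_mul]; norm_num
  have hA' : ‖χ.LFunction 1‖ ≤ 1 / Real.log D ^ (70 + 2 + 9) := by
    rw [show (70 + 2 + 9 : ℕ) = 81 by norm_num]; exact hA
  have h31 : ∑ n ∈ Ioc (D ^ 4) X, ‖divisorSumChar χ n‖ ^ 2 / n ≤ C / ell D ^ 70 :=
    hC D χ hp hχ2 hlog hA' X hXP
  -- the divisor-sum swap and Cauchy–Schwarz
  have hQ : ∀ p, p.Prime → p ≤ D ^ 4 → p ∣ frakq D := fun p hp' hp4 => prime_dvd_frakq hD2 hp' hp4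
  have hmain := sum_coprime_norm_sub_le χ (Skeleton.betaJ_re c' D j) hQ X
  have hcs := sum_norm_divisorSumChar_div_le_sqrt χ (D ^ 4) X
  set H : ℝ := ∑ k ∈ Icc 1 X, (1 : ℝ) / k with hH
  set L : ℝ := ∑ h ∈ Ioc (D ^ 4) X, ‖divisorSumChar χ h‖ ^ 2 / h with hL
  have hH0 : 0 ≤ H := sum_nonneg fun k _ => by positivity
  -- `H ≤ 3𝓛⁹`
  have hHb : H ≤ 3 * ell D ^ 9 := by
    have h1 : H ≤ 1 + Real.log X := Literature.NumberTheory.Sieve.sum_Icc_one_div_le_one_add_log X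
    have h2 : Real.log X ≤ 2 * ell D ^ 9 := by
      rcases Nat.eq_zero_or_pos X with rfl | hX0
      · simp only [Nat.cast_zero, Real.log_zero]; positivity
      · calc Real.log X ≤ Real.log (Real.exp (2 * Real.log D ^ 9)) :=
            Real.log_le_log (by exact_mod_cast hX0) hXP
          _ = 2 * ell D ^ 9 := by rw [Real.log_exp]; rfl
    have h3 : (1 : ℝ) ≤ ell D ^ 9 := one_le_pow₀ hℓ
    linarith
  have hHb1 : 1 ≤ 3 * ell D ^ 9 := by nlinarith [one_le_pow₀ (n := 9) hℓ]
  -- `√L ≤ √|C| / 𝓛³⁵` (the split, free: `70 = 2·35`)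
  have hsqrtL : Real.sqrt L ≤ Real.sqrt |C| / ell D ^ 35 := by
    have hL' : L ≤ (Real.sqrt |C| / ell D ^ 35) ^ 2 := by
      rw [div_pow, Real.sq_sqrt (abs_nonneg C)]
      calc L ≤ C / ell D ^ 70 := h31
        _ ≤ |C| / ell D ^ 70 := by gcongr; exact le_abs_self C
        _ = |C| / (ell D ^ 35) ^ 2 := by rw [← pow_mul]
    calc Real.sqrt L ≤ Real.sqrt ((Real.sqrt |C| / ell D ^ 35) ^ 2) := Real.sqrt_le_sqrt hL'
      _ = Real.sqrt |C| / ell D ^ 35 := Real.sqrt_sq (by positivity)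
  -- `√H ≤ 3𝓛⁹`
  have hsqrtH : Real.sqrt H ≤ 3 * ell D ^ 9 := by
    rw [Real.sqrt_le_left (by positivity)]
    nlinarith
  -- assemble
  have hstar : ∀ n : ℕ, varrhoStar c' χ j n =
      ∑ d ∈ n.divisors, ((d : ℕ) : ℂ) ^ betaJ c' D j * χ ((d : ℕ) : ZMod D) := fun n => rfl
  simp only [hstar]
  calc _ ≤ H ^ 2 * ∑ h ∈ Ioc (D ^ 4) X, ‖divisorSumChar χ h‖ / h := hmain
    _ ≤ H ^ 2 * (Real.sqrt L * Real.sqrt H) := by gcongr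
    _ ≤ (3 * ell D ^ 9) ^ 2 * (Real.sqrt |C| / ell D ^ 35 * (3 * ell D ^ 9)) := by
        gcongr
    _ = 27 * Real.sqrt |C| * (ell D ^ 27 / ell D ^ 35) := by ring
    _ = 27 * Real.sqrt |C| * (1 / ell D ^ 8) := by
        congr 1
        rw [div_eq_div_iff (by positivity) (by positivity), one_mul, ← pow_add]
    _ = 27 * Real.sqrt |C| / ell D ^ 8 := by ring

/-- **(B.1) under `AssumptionAWith E` for every real `E ≥ 81`**, in the skeleton's `ForAllLarge` shape: for all
large `D` and every real primitive `χ` mod `D`, `AssumptionAWith E D χ → ∀ j, ∀ X ≤ ⌊P²⌋,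
Σ_{n≤X,(n,𝔮)=1} |ϱ_j(n) − ϱ*_j(n)|/n ≤ C/𝓛⁸` (the tree's `appB1_bound` is the printed `E = 2022`).
[cite: Zhang2022LandauSiegel, Appendix B (B.1)] -/
theorem appB1_bound_of_assumptionAWith (c' : ℝ) {E : ℝ} (hE : 81 ≤ E) :
    ∃ C : ℝ, ForAllLarge fun D _ χ => AssumptionAWith E D χ →
      ∀ j X : ℕ, X ≤ ⌊bigP D ^ 2⌋₊ →
        ∑ n ∈ (Icc 1 X).filter (fun n => Nat.Coprime n (frakq D)),
          ‖(∑ d ∈ n.divisors, (ArithmeticFunction.moebius d : ℂ) * (d : ℂ) ^ betaJ c' D j) -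
              varrhoStar c' χ j n‖ / n ≤ C / ell D ^ 8 := by
  obtain ⟨C, hC⟩ := appB1_bound_scale_of_norm_le c'
  refine ⟨C, ⌈Real.exp 3⌉₊, fun D _ χ hD hq hp hA j X hX => ?_⟩
  have hD3 : Real.exp 3 ≤ D := le_trans (Nat.le_ceil _) (by exact_mod_cast hD)
  have hD0 : (0 : ℝ) < D := lt_of_lt_of_le (Real.exp_pos 3) hD3
  have hlog : 3 ≤ Real.log D := (Real.le_log_iff_exp_le hD0).mpr hD3
  exact hC D χ hp hq.sq_eq_one hlog
    (norm_le_pow_of_assumptionAWith χ (by linarith) (e := 81) (by exact_mod_cast hE) hA) j X hX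

end Literature.NumberTheory.LFunctions.Zhang2022.Repair.Gap

end
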